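import Summits.Ventures.HSemireg.WeilFrameExistence
import Summits.Ventures.HSemireg.WeilFrameTopLine
import Summits.Ventures.HSemireg.WedgeCarrierEclDividedPowers
import Summits.Ventures.HSemireg.WedgeWeilCarrierRank
import Summits.Ventures.HSemireg.Mod4CarrierMiddleDegree
import Summits.Ventures.HSemireg.ContractionRankWeil

/-!
# Venture HSemireg — THEOREM R_f on the carrier WITHOUT A FRAME: the contraction spans of `Σ q_m Θ^m/m! + w₊ + w₋`
# for an abstract Weil datum `(V; L; P, Q; Θ)`, and THEOREM R on the real carriers `H¹(A)` in the same intrinsic form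

HONEST FRAMING. Part of the Lean index of the computation cell `pub-hsemireg` (seat w3-mod4-1 gen 8, W3 SPECIAL FIBRES,
MOD4-OFFSPLIT §1 / §12). Finite-dimensional exterior / linear algebra over a field, plus the tree's real carriers
(`AbelianVariety ℂ`, `complexBetti`, `hodgeZeroOne`, `totalExteriorClass`, `contractionRank` of `PerfectComplexRankDoor.lean` /
`ContractionRankWeil.lean`) ONLY: no semiregularity map is constructed; nothing here says that HC / HC_CM / HC_AV holds; nothing
here is a claim about any explicit variety; no Literature fact is declared.

WHAT IS PROVED. The carrier theorems (p4 `WeilCarrier.finrank_S_weil_nn_deg` / `…_one`, w3-mod4-1 g6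
`Mod4Carrier.finrank_S_weil_nn_middle_of_top`, p4 `contractionRank_weil`) take an adapted Weil frame `bV` BY VALUE and
the class as the WORD `Ecl bV q (2n) + a·wUp bV n + b·wLow bV n`. Here the same numbers are proved for INTRINSIC data
(characteristic `0`): a Weil datum of type `(n, n)` — `dim V = 4n`; `L ⊆ V` («`H^{0,1}`») of dimension `2n`; disjoint blocks
`P`, `Q` («`H¹_±`») of dimension `2n` each with `dim (L ⊓ P) = dim (L ⊓ Q) = n`; `Θ` in the span of the Weil generating set
`{x ∧ l : (x ∈ P, l ∈ L ⊓ Q) or (x ∈ Q, l ∈ L ⊓ P)}` («a polarisation of Hodge type `(1,1)` and `k`-bidegree `(1,1)`»)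
non-degenerate on `L^⊥` — and the class `x = Σ_{m ≤ 2n} (q_m/m!) Θ^m + w₊ + w₋` with `w₊`, `w₋` NON-ZERO members of the top lines
`(⋀^{2n} P).map (ΛP → ΛV)`, `(⋀^{2n} Q).map (ΛQ → ΛV)` («the two Weil vectors `det H¹_±`, any normalisation»): side degrees
`1 ≤ m ≤ n - 1` (`finrank_S_weilDatum_deg`:
`dim S_m(x) + 2C(n,m)·r_m = 2C(2n,m) + C(2n,m)·r_m`), the one-sided column (`finrank_S_weilDatum_one`), the middle degree with
the eigen-parameter READ OFF THE DATUM (`finrank_S_weilDatum_middle`: if `(2n)!·(w₊ ∧ w₋) = t·Θ^{2n}` then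
`dim S_n(x) + 2r_n + dim ker(M_f(q) - t) = (r_n + 2)·C(2n,n)`), and on the real carriers
(`contractionRank_weilDatum`: `contractionRank A κ = (4 + ρ)n² - 2n` for `A` an abelian variety of dimension `2n ≥ 6` whose
`H¹(A)` carries such a datum with `L = H^{0,1}(A)` and whose total class is such an `x`). PROOF = the three dictionary files:
an adapted frame EXISTS (`WeilFrame.exists_adapted_basis`), `w₊`, `w₋` are unit multiples of its `wUp`, `wLow`
(`WeilFrame.exists_eq_smul_wUp/_wLow`), and `Σ (q_m/m!) Θ^m = Ecl bV q` (`WeilFrame.Ecl_eq_hPart`); then the frame theorems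
apply verbatim. So the non-Lean input of THEOREM R / R_f on the carrier is no longer «identification with an adapted Weil frame»
but only «`(H¹, H^{0,1}, H¹_±, h)` of a polarised Weil-type abelian variety is a Weil datum and `HT` acts by `L`, `Ann L`» — the
definition of Weil type plus `H^•(A) = ΛH¹`. Everything PROVED, 0 sorry; NO definition is introduced.
References: [BourbakiAlgebre1a3] Ch. III §7, §11 no. 9; [BuchweitzFlenner2008HH] Prop. 6.4.4; [MumfordAV1970] §1 (4), §4 (iii).
-/

noncomputable section

open CliffordAlgebra (contractLeft)
open ExteriorAlgebra (ι)
open Module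

namespace Summit.Ventures.HSemireg.WeilFrame

open Summit.Ventures.HSemireg.WedgeBridge Summit.Ventures.HSemireg.WeilCarrier Summit.Ventures.HSemireg.Mod4Carrier
open Summit.Ventures.HSemireg.Wedge.Hankel

variable {K : Type*} [Field K] {V : Type*} [AddCommGroup V] [Module K V]

/-! ### 1. From a Weil datum of type `(n, n)` to an adapted frame carrying the given class -/

/-- **the dictionary in one statement:** a Weil datum of type `(n,n)` with non-zero Weil vectors `w₊`, `w₋` in the top lines of
`P`, `Q` admits an adapted basis `bV` with `Lsp bV = L`, `Θ = Σ_{j<2n} ℓ_j ∧ m_j`, `w₊ = a·wUp bV n`, `w₋ = b·wLow bV n`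
(`a, b ≠ 0`), and `Σ_{m ≤ 2n} (q_m/m!) Θ^m = Ecl bV q (2n)` for every `q` (characteristic `0`).
[cite: BourbakiAlgebre1a3, Ch. II §7 no. 5] [cite: BourbakiAlgebre1a3, Ch. III §7 no. 8] -/
theorem exists_frame_of_weilDatum [FiniteDimensional K V] [CharZero K] {n : ℕ} {L P Q : Submodule K V}
    {Θ wP wQ : ExteriorAlgebra K V} (hV : finrank K V = (n + n) + (n + n)) (hPQ : Disjoint P Q)
    (hL : finrank K L = n + n) (hLQ : finrank K ↥(L ⊓ Q) = n) (hLP : finrank K ↥(L ⊓ P) = n)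
    (hP : finrank K ↥P = n + n) (hQ : finrank K ↥Q = n + n) (hΘ : Θ ∈ Submodule.span K
      {z : ExteriorAlgebra K V | ∃ x l : V, ((x ∈ P ∧ l ∈ L ⊓ Q) ∨ (x ∈ Q ∧ l ∈ L ⊓ P)) ∧ z = ι K x * ι K l})
    (hnd : ∀ l ∈ (L : Set V), ι K l ∈ Submodule.span K {y : ExteriorAlgebra K V |
      ∃ φ ∈ {θ : Module.Dual K V | ∀ q ∈ L, θ q = 0}, y = contractLeft φ Θ})
    (hwP : wP ∈ ((⋀[K]^(finrank K ↥P) ↥P).map (ExteriorAlgebra.map P.subtype).toLinearMap)) (hwP0 : wP ≠ 0)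
    (hwQ : wQ ∈ ((⋀[K]^(finrank K ↥Q) ↥Q).map (ExteriorAlgebra.map Q.subtype).toLinearMap)) (hwQ0 : wQ ≠ 0) :
    ∃ (bV : Basis (Fin ((n + n) + (n + n))) K V) (a b : K), a ≠ 0 ∧ b ≠ 0 ∧ Lsp bV = L ∧
      Θ = (∑ j ∈ Finset.range (n + n), LM bV j) ∧ wP = a • wUp bV n ∧ wQ = b • wLow bV n ∧
      ∀ q : ℕ → K, (∑ m ∈ Finset.range (n + n + 1), (q m * ((m.factorial : ℕ) : K)⁻¹) • Θ ^ m) = Ecl bV q (n + n) := by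
  obtain ⟨bV, hLsp, hlt, hge, hΘ'⟩ := exists_adapted_basis hV L P Q hPQ hL hLQ hLP hΘ hnd
  have hn : n ≤ n + n := Nat.le_add_right n n
  obtain ⟨a, ha, hwa⟩ := exists_eq_smul_wUp bV hn hP (fun c hc => (hge c hc).1) (fun c hc => (hlt c hc).2) hwP hwP0
  obtain ⟨b, hb, hwb⟩ := exists_eq_smul_wLow bV hn hQ (fun c hc => (hlt c hc).1) (fun c hc => (hge c hc).2) hwQ hwQ0
  have hT : Θ = (∑ j ∈ Finset.range (n + n), LM bV j) := by rw [hΘ', ThetaN_eq_sum]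
  exact ⟨bV, a, b, ha, hb, hLsp, hT, hwa, hwb, fun q => by rw [hT, Ecl_eq_hPart]⟩

/-! ### 2. THEOREM R_f on the carrier for a Weil datum (no frame in the statement) -/

/-- **side degrees, both Weil vectors alive, `1 ≤ m ≤ n - 1`:** for a Weil datum of type `(n,n)` and
`x = Σ_{m ≤ 2n} (q_m/m!) Θ^m + w₊ + w₋` (`w₊`, `w₋` non-zero in the top lines of `P`, `Q`),
`dim S_m(x) + (C(n,m) + C(n,m))·r_m(q) = C(2n,m) + C(2n,m) + C(2n,m)·r_m(q)` — p4's `finrank_S_weil_nn_deg` without a frame.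
[cite: BuchweitzFlenner2008HH, Prop. 6.4.4] [cite: BourbakiAlgebre1a3, Ch. III §11 no. 9] -/
theorem finrank_S_weilDatum_deg [FiniteDimensional K V] [CharZero K] {n : ℕ} {L P Q : Submodule K V}
    {Θ wP wQ : ExteriorAlgebra K V} (hV : finrank K V = (n + n) + (n + n)) (hPQ : Disjoint P Q)
    (hL : finrank K L = n + n) (hLQ : finrank K ↥(L ⊓ Q) = n) (hLP : finrank K ↥(L ⊓ P) = n)
    (hP : finrank K ↥P = n + n) (hQ : finrank K ↥Q = n + n) (hΘ : Θ ∈ Submodule.span K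
      {z : ExteriorAlgebra K V | ∃ x l : V, ((x ∈ P ∧ l ∈ L ⊓ Q) ∨ (x ∈ Q ∧ l ∈ L ⊓ P)) ∧ z = ι K x * ι K l})
    (hnd : ∀ l ∈ (L : Set V), ι K l ∈ Submodule.span K {y : ExteriorAlgebra K V |
      ∃ φ ∈ {θ : Module.Dual K V | ∀ q ∈ L, θ q = 0}, y = contractLeft φ Θ})
    (hwP : wP ∈ ((⋀[K]^(finrank K ↥P) ↥P).map (ExteriorAlgebra.map P.subtype).toLinearMap)) (hwP0 : wP ≠ 0)
    (hwQ : wQ ∈ ((⋀[K]^(finrank K ↥Q) ↥Q).map (ExteriorAlgebra.map Q.subtype).toLinearMap)) (hwQ0 : wQ ≠ 0)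
    (q : ℕ → K) {m : ℕ} (hm1 : 1 ≤ m) (hmn : m + 1 ≤ n) :
    finrank K ↥(S K L m ((∑ m ∈ Finset.range (n + n + 1), (q m * ((m.factorial : ℕ) : K)⁻¹) • Θ ^ m) + wP + wQ)) +
        (n.choose m + n.choose m) * (hankel1 K (n + n) m q).rank =
      (n + n).choose m + (n + n).choose m + (n + n).choose m * (hankel1 K (n + n) m q).rank := by
  obtain ⟨bV, a, b, ha, hb, hLsp, -, rfl, rfl, hE⟩ :=
    exists_frame_of_weilDatum hV hPQ hL hLQ hLP hP hQ hΘ hnd hwP hwP0 hwQ hwQ0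
  rw [← hLsp, hE]
  exact finrank_S_weil_nn_deg bV hm1 hmn q ha hb

/-- **one-sided column (`w₋`-part absent), `m + 1 ≤ n`:** `dim S_m(Σ (q_m/m!) Θ^m + w₊) + C(n,m)·r_m = C(2n,m) + C(2n,m)·r_m` —
p4's `finrank_S_weil_nn_one` without a frame (the `w₊`-part-absent side is the mirror datum `(L; Q, P)`).
[cite: BuchweitzFlenner2008HH, Prop. 6.4.4] [cite: BourbakiAlgebre1a3, Ch. III §11 no. 9] -/
theorem finrank_S_weilDatum_one [FiniteDimensional K V] [CharZero K] {n : ℕ} {L P Q : Submodule K V}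
    {Θ wP wQ : ExteriorAlgebra K V} (hV : finrank K V = (n + n) + (n + n)) (hPQ : Disjoint P Q)
    (hL : finrank K L = n + n) (hLQ : finrank K ↥(L ⊓ Q) = n) (hLP : finrank K ↥(L ⊓ P) = n)
    (hP : finrank K ↥P = n + n) (hQ : finrank K ↥Q = n + n) (hΘ : Θ ∈ Submodule.span K
      {z : ExteriorAlgebra K V | ∃ x l : V, ((x ∈ P ∧ l ∈ L ⊓ Q) ∨ (x ∈ Q ∧ l ∈ L ⊓ P)) ∧ z = ι K x * ι K l})
    (hnd : ∀ l ∈ (L : Set V), ι K l ∈ Submodule.span K {y : ExteriorAlgebra K V |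
      ∃ φ ∈ {θ : Module.Dual K V | ∀ q ∈ L, θ q = 0}, y = contractLeft φ Θ})
    (hwP : wP ∈ ((⋀[K]^(finrank K ↥P) ↥P).map (ExteriorAlgebra.map P.subtype).toLinearMap)) (hwP0 : wP ≠ 0)
    (hwQ : wQ ∈ ((⋀[K]^(finrank K ↥Q) ↥Q).map (ExteriorAlgebra.map Q.subtype).toLinearMap)) (hwQ0 : wQ ≠ 0)
    (q : ℕ → K) {m : ℕ} (hmn : m + 1 ≤ n) :
    finrank K ↥(S K L m ((∑ m ∈ Finset.range (n + n + 1), (q m * ((m.factorial : ℕ) : K)⁻¹) • Θ ^ m) + wP)) +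
        n.choose m * (hankel1 K (n + n) m q).rank =
      (n + n).choose m + (n + n).choose m * (hankel1 K (n + n) m q).rank := by
  obtain ⟨bV, a, b, ha, -, hLsp, -, rfl, -, hE⟩ :=
    exists_frame_of_weilDatum hV hPQ hL hLQ hLP hP hQ hΘ hnd hwP hwP0 hwQ hwQ0
  rw [← hLsp, hE]
  exact finrank_S_weil_nn_one bV hmn q ha

/-- `(2n)! · LMprod bV (2n) = Θ^{2n}`: the point class is the top divided power of `Θ`. -/
lemma factorial_smul_LMprod_eq_pow {N : ℕ} (bV : Basis (Fin (N + N)) K V) :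
    ((N.factorial : ℕ) : K) • LMprod bV N = (∑ j ∈ Finset.range (N), LM bV j) ^ N := by
  rw [← Ecl_delta_top, factorial_smul_layer_eq_pow]

/-- **middle degree with the eigen-parameter READ OFF THE DATUM:** if moreover `(2n)!·(w₊ ∧ w₋) = t·Θ^{2n}` (i.e.
`w₊ ∧ w₋ = t·Θ^{2n}/(2n)!`), then `dim S_n(Σ (q_m/m!) Θ^m + w₊ + w₋) + 2r_n + dim ker(M_f(q) - t) = (r_n + 2)·C(2n,n)` —
w3-mod4-1 g6's `finrank_S_weil_nn_middle_of_top` without a frame; geometrically `t = ∫w₊w₋/D = (-1)ⁿτ`.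
[cite: BuchweitzFlenner2008HH, Prop. 6.4.4] [cite: BourbakiAlgebre1a3, Ch. III §11 no. 9] -/
theorem finrank_S_weilDatum_middle [FiniteDimensional K V] [CharZero K] {n : ℕ} {L P Q : Submodule K V}
    {Θ wP wQ : ExteriorAlgebra K V} (hV : finrank K V = (n + n) + (n + n)) (hPQ : Disjoint P Q)
    (hL : finrank K L = n + n) (hLQ : finrank K ↥(L ⊓ Q) = n) (hLP : finrank K ↥(L ⊓ P) = n)
    (hP : finrank K ↥P = n + n) (hQ : finrank K ↥Q = n + n) (hΘ : Θ ∈ Submodule.span K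
      {z : ExteriorAlgebra K V | ∃ x l : V, ((x ∈ P ∧ l ∈ L ⊓ Q) ∨ (x ∈ Q ∧ l ∈ L ⊓ P)) ∧ z = ι K x * ι K l})
    (hnd : ∀ l ∈ (L : Set V), ι K l ∈ Submodule.span K {y : ExteriorAlgebra K V |
      ∃ φ ∈ {θ : Module.Dual K V | ∀ q ∈ L, θ q = 0}, y = contractLeft φ Θ})
    (hwP : wP ∈ ((⋀[K]^(finrank K ↥P) ↥P).map (ExteriorAlgebra.map P.subtype).toLinearMap)) (hwP0 : wP ≠ 0)
    (hwQ : wQ ∈ ((⋀[K]^(finrank K ↥Q) ↥Q).map (ExteriorAlgebra.map Q.subtype).toLinearMap)) (hwQ0 : wQ ≠ 0) (hn : 1 ≤ n)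
    (q : ℕ → K) {t : K} (ht : (((n + n).factorial : ℕ) : K) • (wP * wQ) = t • Θ ^ (n + n)) :
    finrank K ↥(S K L n ((∑ m ∈ Finset.range (n + n + 1), (q m * ((m.factorial : ℕ) : K)⁻¹) • Θ ^ m) + wP + wQ)) +
        2 * (hankel1 K (n + n) n q).rank +
        finrank K ↥(LinearMap.ker (Matrix.toLin' (Mod4.middleM n q) - t • LinearMap.id)) =
      ((hankel1 K (n + n) n q).rank + 2) * (n + n).choose n := by
  obtain ⟨bV, a, b, ha, hb, hLsp, hT, rfl, rfl, hE⟩ :=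
    exists_frame_of_weilDatum hV hPQ hL hLQ hLP hP hQ hΘ hnd hwP hwP0 hwQ hwQ0
  have ht' : (a • wUp bV n) * (b • wLow bV n) = t • LMprod bV (n + n) := by
    have hfac : (((n + n).factorial : ℕ) : K) ≠ 0 := Nat.cast_ne_zero.mpr (Nat.factorial_ne_zero _)
    apply smul_right_injective (ExteriorAlgebra K V) hfac
    dsimp only
    rw [ht, smul_comm, factorial_smul_LMprod_eq_pow, hT]
  rw [← hLsp, hE]
  exact finrank_S_weil_nn_middle_of_top bV hn q ha hb ht'

/-! ### 3. THEOREM R on the real carriers for a Weil datum on `H¹(A)` -/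

open Literature.AlgebraicGeometry.Motives Literature.AlgebraicGeometry.HodgeTheory in
/-- **THEOREM R on the real carriers, intrinsic form (Weil type `(n, n)`, `n ≥ 3`):** let `A` be a complex abelian variety
of dimension `2n` whose `H¹(A; ℂ)` carries a Weil datum with `L = H^{0,1}(A)` — disjoint blocks `P`, `Q` of dimension `2n`
with `dim (H^{0,1} ⊓ P) = dim (H^{0,1} ⊓ Q) = n`, a 2-vector `Θ` in the span of the Weil generating set of `(H^{0,1}; P, Q)`,
non-degenerate on `(H^{0,1})^⊥` — and whose total class is `Σ_{m ≤ 2n} (q_m/m!) Θ^m + w₊ + w₋` with `w₊`, `w₋` non-zero members of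
the top lines of `P`, `Q`. Then
`contractionRank A κ = 4n² + n²·rank H₂(q) - 2n = (4 + ρ)n² - 2n` — p4's `contractionRank_weil` with NO frame by value.
[cite: BuchweitzFlenner2008HH, Prop. 6.4.4] [cite: MumfordAV1970, §1 (4) and §4 (iii)] -/
theorem contractionRank_weilDatum {A : AbelianVariety ℂ} (hA : IsSmoothProjective A.dim A.X)
    (κ : ∀ p : ℕ, complexBetti A.X (2 * p)) {n : ℕ} (hn : 3 ≤ n) (hdim : A.dim = n + n)
    {P Q : Submodule ℂ (complexBetti A.X 1)} {Θ wP wQ : ExteriorAlgebra ℂ (complexBetti A.X 1)}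
    (hPQ : Disjoint P Q) (hLQ : finrank ℂ ↥(hodgeZeroOne hA ⊓ Q) = n) (hLP : finrank ℂ ↥(hodgeZeroOne hA ⊓ P) = n)
    (hP : finrank ℂ ↥P = n + n) (hQ : finrank ℂ ↥Q = n + n)
    (hΘ : Θ ∈ Submodule.span ℂ {z : ExteriorAlgebra ℂ (complexBetti A.X 1) | ∃ x l : complexBetti A.X 1,
      ((x ∈ P ∧ l ∈ hodgeZeroOne hA ⊓ Q) ∨ (x ∈ Q ∧ l ∈ hodgeZeroOne hA ⊓ P)) ∧ z = ι ℂ x * ι ℂ l})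
    (hnd : ∀ l ∈ (hodgeZeroOne hA : Set (complexBetti A.X 1)), ι ℂ l ∈ Submodule.span ℂ
      {y : ExteriorAlgebra ℂ (complexBetti A.X 1) |
        ∃ φ ∈ {θ : Module.Dual ℂ (complexBetti A.X 1) | ∀ v ∈ hodgeZeroOne hA, θ v = 0}, y = contractLeft φ Θ})
    (hwP : wP ∈ ((⋀[ℂ]^(finrank ℂ ↥P) ↥P).map (ExteriorAlgebra.map P.subtype).toLinearMap)) (hwP0 : wP ≠ 0)
    (hwQ : wQ ∈ ((⋀[ℂ]^(finrank ℂ ↥Q) ↥Q).map (ExteriorAlgebra.map Q.subtype).toLinearMap)) (hwQ0 : wQ ≠ 0) (q : ℕ → ℂ)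
    (hx : totalExteriorClass A κ =
      (∑ m ∈ Finset.range (n + n + 1), (q m * ((m.factorial : ℕ) : ℂ)⁻¹) • Θ ^ m) + wP + wQ) :
    contractionRank A κ = ((4 * (n * n) + n * n * (hankel1 ℂ (n + n) 2 q).rank - 2 * n : ℕ) : Cardinal) := by
  haveI : Module.Finite ℂ (complexBetti A.X 1) := abelianVarietyCohomologyExteriorH1_holds.finite_one A
  have hV : finrank ℂ (complexBetti A.X 1) = (n + n) + (n + n) := by
    rw [Literature.AlgebraicGeometry.Motives.AbelianVariety.finrank_complexBetti_one, hdim]; ring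
  have hL : finrank ℂ ↥(hodgeZeroOne hA) = n + n := by rw [AbelianVariety.finrank_hodgeZeroOne_eq_dim A hA, hdim]
  obtain ⟨bV, a, b, ha, hb, hLsp, -, rfl, rfl, hE⟩ :=
    exists_frame_of_weilDatum hV hPQ hL hLQ hLP hP hQ hΘ hnd hwP hwP0 hwQ hwQ0
  rw [hE] at hx
  exact contractionRank_weil hA κ hn bV hLsp.symm q ha hb hx

end Summit.Ventures.HSemireg.WeilFrame

end
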